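import Summits.BirchSwinnertonDyer.BirchSwinnertonDyer.Theses.SemiOrdinaryEisensteinDescent
import Summits.BirchSwinnertonDyer.BirchSwinnertonDyer.Theorems.SemiOrdinaryEisensteinDescentWildSplitEisensteinInclusionAtThreeValueAtOne
import Literature.NumberTheory.EllipticCurves.IwasawaAlgebraRankOneIdealProofs
import Literature.NumberTheory.EllipticCurves.UnrIntegersUnits
import HarnessLib

/-!
# Crux E `WildSplitEisensteinInclusionAtThree` (stmt-BirchSwinnertonDyer-20479): the LEADING-TERM CRITERION —
# modulo UTD's Kolyvagin inclusion (20395) the Λ-adic Eisenstein inclusion IS its bottom-layer shadow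
# (cell `pub/bsd-wall`, width seat `bsd-wall-soed-p1-w2` g2, `--supports 20479`, helper)

Route `SemiOrdinaryEisensteinDescent` (SOED). The sibling file `…WildSplitEisensteinInclusionAtThreeValueAtOne`
(w3 g0, p580416) proved crux E ⟹ its value-at-𝟙 residual `E_𝟙` («`‖f(𝟙)‖₃ ≤ ‖L(𝟙)‖` for a generator `f` of
`Ch_Λ(X_(∅,0))`») and that the route's kernel consumes E ONLY through `E_𝟙`, at frames where control
(crux C, 20386) has already supplied CTL₀ (`f(𝟙) ≠ 0`). THIS FILE proves the CONVERSE on that locus, modulo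
route UTD's wall `AdditiveSplitIMCInclusionAtThree` (stmt-BirchSwinnertonDyer-20395, the Kolyvagin-direction
inclusion `(L) ⊆ Ch_Λ(X_(∅,0))·R₀⟦T⟧`; its signature is DISPLAYED verbatim as a hypothesis, UTD's route file is
not imported), and the order-of-vanishing generalisation that removes the locus restriction:

* §1 ALGEBRA in `R₀⟦T⟧` (every prime `p`; `R₀ = unrIntegers p ⊂ ℂ_p`, elements of norm `≤ 1`, units = norm
  `1` by Literature `unrIntegers.isUnit_iff_norm_eq_one`). **`span_eq_span_of_span_le_of_norm_coeff_le`**: if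
  `(L) ⊆ (g)` (`g ∣ L`), `g_0 = … = g_{r-1} = 0`, `g_r ≠ 0` and `‖g_r‖ ≤ ‖L_r‖`, then `(g) = (L)`. Proof:
  `L = h·g` gives `L_r = g_r·h(0)` (`coeff_mul_eq_of_coeff_lt_eq_zero`), so `‖g_r‖ ≤ ‖g_r‖·‖h(0)‖` forces
  `‖h(0)‖ = 1`, `h(0) ∈ R₀ˣ`, `h ∈ R₀⟦T⟧ˣ`. Case `r = 0`: `span_eq_span_of_span_le_of_norm_constantCoeff_le`;
  mixed currency `f ∈ ℤ_p⟦T⟧ ↦ R₀⟦T⟧` (the kernel's shapes): `map_span_eq_span_of_span_le_of_norm_coeff_le`,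
  `map_span_eq_span_of_span_le_of_norm_constantCoeff_le`.
* §2 ON THE CTL₀ LOCUS (the displayed shape `E^{CTL₀}` = crux E's binders and torsion guard VERBATIM, conclusion
  «for every generator `f` of `Ch_Λ(X_(∅,0))` with `f(𝟙) ≠ 0`, `Ch_Λ(X_(∅,0))·R₀⟦T⟧ ⊆ (L)`» — NOT a new item or
  definition): **`imcEqualityCTL_of_kolyvaginInclusion_of_valueAtOne`** (UTD 20395 displayed + `E_𝟙` displayed ⟹
  the `(∅,0)` main-conjecture EQUALITY `Ch·R₀⟦T⟧ = (L)` at every CTL₀ frame), hence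
  **`cruxCTL_of_kolyvaginInclusion_of_valueAtOne`**; conversely `cruxCTL_of_crux` (trivial) and
  **`valueAtOne_of_cruxCTL`** (`E^{CTL₀} ⟹ E_𝟙`: off CTL₀ the inequality `‖0‖ ≤ ‖L(𝟙)‖` is empty); so
  **`cruxCTL_iff_valueAtOne_of_kolyvaginInclusion`**: modulo 20395, `E^{CTL₀} ⟺ E_𝟙`; and the leaf
  `WAllExclAddWildRankOneSurj` from `E^{CTL₀}` in place of E (`wAllExclAddWildRankOneSurj_of_cruxCTL`, through
  w3's `wAllExclAddWildRankOneSurj_of_valueAtOne` by name).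
* §3 OFF THE LOCUS (the fields `K` with `L(E^(d_K),1) = 0`, `r_an(E/K) ≥ 3`, over which crux E also quantifies
  and where `f(𝟙) = 0 = L(𝟙)`): the LEADING-TERM display `E_lead` («for every generator `f` and every `r` with
  `f_0 = … = f_{r-1} = 0 ≠ f_r`: `‖f_r‖₃ ≤ ‖L_r‖`», the inequality between the leading Taylor coefficients at
  the trivial character). **`crux_of_kolyvaginInclusion_of_leadingTerm`**: UTD 20395 + `E_lead` ⟹ crux E BY NAME
  (no locus restriction; `Ch_Λ` is principal by Literature `charIdeal_isPrincipal_holds`); and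
  **`leadingTerm_of_crux_of_kolyvaginInclusion`**: E + 20395 ⟹ `E_lead`. So MODULO UTD's WALL, CRUX E IS
  EQUIVALENT TO `E_lead` (`crux_iff_leadingTerm_of_kolyvaginInclusion`), and on the kernel's locus to `E_𝟙`.

PLANNING READING (for the SOED pen; nothing is claimed about 20395, E, `E_𝟙` or `E_lead`): given UTD's Kolyvagin
inclusion, the Λ-adic content of crux E beyond the bottom-layer index inequality `E_𝟙` (in index currency
«`ord₃#Ш(E/K)[3^∞] + 2·ord₃∏c_q + 2·ord₃c ≥ 2·ord₃[E(K):ℤP]`», the converse of the Kolyvagin crux Ko) lives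
ONLY at the fields `K` off the CTL₀ locus, which the leaf never visits, and there it is the leading-coefficient
inequality at `𝟙` (Λ-adic Gross–Zagier / derived-height territory), not new Eisenstein-congruence content. The
two research walls of row 2·3@3 lane 3 — UTD's `⊇` and SOED's `⊆` — therefore differ, on the kernel's locus, by
exactly the `3`-part of the BSD formula over `K`.

HONEST STATUS: no progress on E itself; 20395, `E_𝟙`, `E_lead` are antecedents; no definition, no named fact, no
`sorry`; BSD is not proved for any curve. Supports, does not close, stmt-BirchSwinnertonDyer-20479.

References: [JetchevSkinnerWan2017] §7.4.1 (arXiv:1512.06894 p. 30) (STEP L at the bottom layer);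
[Washington1997] §7.1 and §13.2 (units of `𝒪⟦T⟧`; principal characteristic ideals); [Castella2018] Thm. 2.3,
§5 (5.1)–(5.3) (the frames); folklore (ultrametric norms in `ℂ_p`).
-/

noncomputable section

open scoped Classical

set_option linter.dupNamespace false
set_option autoImplicit false

namespace Summit.BirchSwinnertonDyer.BirchSwinnertonDyer.Theorems.WildSplitEisensteinInclusionAtThreeLeadingTerm

open PowerSeries NumberField IsDedekindDomain Field
  Literature.NumberTheory.EllipticCurves
  Summit.BirchSwinnertonDyer.Rank1Residual.X11b
  Summit.BirchSwinnertonDyer.Rank1Residual.X11b.Halves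
  Summit.BirchSwinnertonDyer.BirchSwinnertonDyer.Theses.SemiOrdinaryEisensteinDescent
  Summit.BirchSwinnertonDyer.BirchSwinnertonDyer.Theorems

/-! ### §1 Algebra in `R₀⟦T⟧`: equality behind a divisibility from the leading coefficients -/

section Algebra

variable {p : ℕ} [Fact p.Prime]

/-- If the coefficients of `g` below degree `r` vanish then `(g·h)_r = g_r·h(0)` (only the summand `(r, 0)` of
the Cauchy product survives). [folklore] -/
theorem coeff_mul_eq_of_coeff_lt_eq_zero {R : Type*} [CommSemiring R] {g : PowerSeries R} (h : PowerSeries R)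
    {r : ℕ} (hg : ∀ i < r, coeff i g = 0) :
    coeff r (g * h) = coeff r g * constantCoeff h := by
  rw [coeff_mul, Finset.sum_eq_single (r, 0)]
  · rw [coeff_zero_eq_constantCoeff_apply]
  · rintro ⟨i, j⟩ hij hne
    have hij' : i + j = r := Finset.HasAntidiagonal.mem_antidiagonal.mp hij
    have hi : i < r := by
      by_contra hi
      have h1 : i = r := by omega
      have h2 : j = 0 := by omega
      exact hne (by rw [h1, h2])
    simp only [hg i hi, zero_mul]
  · intro h
    exact absurd (Finset.HasAntidiagonal.mem_antidiagonal.mpr (Nat.add_zero r) : (r, 0) ∈ Finset.HasAntidiagonal.antidiagonal r) h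

/-- A non-zero element of `R₀ ⊂ ℂ_p` has positive norm. [folklore] -/
theorem norm_coe_pos_of_ne_zero {x : unrIntegers p} (hx : x ≠ 0) : 0 < ‖(x : ℂ_[p])‖ := by
  rw [norm_pos_iff]
  exact fun h ↦ hx (by exact_mod_cast h)

/-- **The leading-term criterion.** In `R₀⟦T⟧`: if `(L) ⊆ (g)` (the Kolyvagin direction `g ∣ L`), the
coefficients of `g` below degree `r` vanish, `g_r ≠ 0`, and `‖g_r‖ ≤ ‖L_r‖` in `ℂ_p` (the Eisenstein direction
READ ON THE LEADING COEFFICIENT ONLY), then `(g) = (L)`. Indeed `L = h·g`, `L_r = g_r·h(0)`,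
`‖g_r‖ ≤ ‖g_r‖·‖h(0)‖` with `‖g_r‖ > 0` and `‖h(0)‖ ≤ 1` give `‖h(0)‖ = 1`, so `h(0) ∈ R₀ˣ`
(`unrIntegers.isUnit_iff_norm_eq_one`) and `h ∈ R₀⟦T⟧ˣ`. [cite: Washington1997, §7.1] -/
theorem span_eq_span_of_span_le_of_norm_coeff_le {g L : UnrSeries p} {r : ℕ}
    (hle : Ideal.span {L} ≤ Ideal.span {g}) (hg : ∀ i < r, coeff i g = 0) (hgr : coeff r g ≠ 0)
    (hnorm : ‖((coeff r g : unrIntegers p) : ℂ_[p])‖ ≤ ‖((coeff r L : unrIntegers p) : ℂ_[p])‖) :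
    Ideal.span {g} = Ideal.span {L} := by
  obtain ⟨h, hh⟩ := Ideal.mem_span_singleton'.mp (hle (Ideal.mem_span_singleton_self L))
  -- `L = h * g`; the `r`-th coefficient: `L_r = g_r · h(0)`
  have hLr : coeff r L = coeff r g * constantCoeff h := by
    rw [← hh, mul_comm h g, coeff_mul_eq_of_coeff_lt_eq_zero h hg]
  have hpos : 0 < ‖((coeff r g : unrIntegers p) : ℂ_[p])‖ := norm_coe_pos_of_ne_zero hgr
  have hh0 : ‖((constantCoeff h : unrIntegers p) : ℂ_[p])‖ = 1 := by
    refine le_antisymm (norm_coe_unrIntegers_le_one p _) ?_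
    have h1 : ‖((coeff r g : unrIntegers p) : ℂ_[p])‖ * 1 ≤
        ‖((coeff r g : unrIntegers p) : ℂ_[p])‖ * ‖((constantCoeff h : unrIntegers p) : ℂ_[p])‖ := by
      rw [mul_one, ← norm_mul, ← Subring.coe_mul, ← hLr]
      exact hnorm
    exact le_of_mul_le_mul_left h1 hpos
  have hu : IsUnit h :=
    PowerSeries.isUnit_iff_constantCoeff.mpr ((unrIntegers.isUnit_iff_norm_eq_one _).mpr hh0)
  rw [← hh, Ideal.span_singleton_mul_left_unit hu]

/-- **The CTL₀ case `r = 0`**: `(L) ⊆ (g)`, `g(0) ≠ 0` and `‖g(0)‖ ≤ ‖L(0)‖` give `(g) = (L)`.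
[cite: Washington1997, §7.1] -/
theorem span_eq_span_of_span_le_of_norm_constantCoeff_le {g L : UnrSeries p}
    (hle : Ideal.span {L} ≤ Ideal.span {g}) (hg0 : constantCoeff g ≠ 0)
    (hnorm : ‖((constantCoeff g : unrIntegers p) : ℂ_[p])‖ ≤
      ‖((constantCoeff L : unrIntegers p) : ℂ_[p])‖) :
    Ideal.span {g} = Ideal.span {L} := by
  refine span_eq_span_of_span_le_of_norm_coeff_le (r := 0) hle (fun i hi ↦ absurd hi (Nat.not_lt_zero i))
    ?_ ?_
  · rwa [coeff_zero_eq_constantCoeff_apply]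
  · simpa only [coeff_zero_eq_constantCoeff_apply] using hnorm

/-- The coefficients of `ι(f) ∈ R₀⟦T⟧` (`ι : ℤ_p → R₀`) read in `ℂ_p` are those of `f` read in `ℚ_p`:
`‖ι(f)_r‖ = ‖f_r‖`. [folklore] -/
theorem norm_coeff_map_toUnr (f : IwasawaAlgebra p) (r : ℕ) :
    ‖((coeff r (PowerSeries.map (toUnr p) f) : unrIntegers p) : ℂ_[p])‖ = ‖((coeff r f : ℤ_[p]) : ℚ_[p])‖ := by
  rw [coeff_map, coe_toUnr, norm_algebraMap']

/-- `ι(f)_r = 0 ↔ f_r = 0` (`ℤ_p → R₀ ⊂ ℂ_p` is injective). [folklore] -/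
theorem coeff_map_toUnr_eq_zero_iff (f : IwasawaAlgebra p) (r : ℕ) :
    coeff r (PowerSeries.map (toUnr p) f) = 0 ↔ coeff r f = 0 := by
  rw [coeff_map]
  constructor
  · intro h0
    have h1 : ((toUnr p (coeff r f) : unrIntegers p) : ℂ_[p]) = 0 := by rw [h0]; rfl
    rwa [coe_toUnr, _root_.map_eq_zero, PadicInt.coe_eq_zero] at h1
  · intro h0
    rw [h0, map_zero]

/-- **Mixed currency (the kernel's shapes), general `r`.** For `f ∈ Λ = ℤ_p⟦T⟧` and `L ∈ R₀⟦T⟧`: if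
`(L) ⊆ (f)·R₀⟦T⟧`, `f_0 = … = f_{r-1} = 0 ≠ f_r` and `‖f_r‖ ≤ ‖L_r‖`, then `(f)·R₀⟦T⟧ = (L)`.
[cite: Washington1997, §7.1] -/
theorem map_span_eq_span_of_span_le_of_norm_coeff_le {f : IwasawaAlgebra p} {L : UnrSeries p} {r : ℕ}
    (hle : Ideal.span {L} ≤ (Ideal.span {f}).map (PowerSeries.map (toUnr p)))
    (hf : ∀ i < r, coeff i f = 0) (hfr : coeff r f ≠ 0)
    (hnorm : ‖((coeff r f : ℤ_[p]) : ℚ_[p])‖ ≤ ‖((coeff r L : unrIntegers p) : ℂ_[p])‖) :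
    (Ideal.span {f}).map (PowerSeries.map (toUnr p)) = Ideal.span {L} := by
  rw [CongruenceLimit.map_span_singleton_powerSeries] at hle ⊢
  refine span_eq_span_of_span_le_of_norm_coeff_le hle
    (fun i hi ↦ (coeff_map_toUnr_eq_zero_iff f i).mpr (hf i hi)) ?_ ?_
  · exact fun h0 ↦ hfr ((coeff_map_toUnr_eq_zero_iff f r).mp h0)
  · rwa [norm_coeff_map_toUnr]

/-- **Mixed currency, CTL₀ case `r = 0`**: `(L) ⊆ (f)·R₀⟦T⟧`, `f(0) ≠ 0`, `‖f(0)‖ ≤ ‖L(0)‖` ⟹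
`(f)·R₀⟦T⟧ = (L)`. [cite: Washington1997, §7.1] -/
theorem map_span_eq_span_of_span_le_of_norm_constantCoeff_le {f : IwasawaAlgebra p} {L : UnrSeries p}
    (hle : Ideal.span {L} ≤ (Ideal.span {f}).map (PowerSeries.map (toUnr p)))
    (hf0 : constantCoeff f ≠ 0)
    (hnorm : ‖((constantCoeff f : ℤ_[p]) : ℚ_[p])‖ ≤ ‖((constantCoeff L : unrIntegers p) : ℂ_[p])‖) :
    (Ideal.span {f}).map (PowerSeries.map (toUnr p)) = Ideal.span {L} := by
  refine map_span_eq_span_of_span_le_of_norm_coeff_le (r := 0) hle (fun i hi ↦ absurd hi (Nat.not_lt_zero i))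
    ?_ ?_
  · rwa [coeff_zero_eq_constantCoeff_apply]
  · simpa only [coeff_zero_eq_constantCoeff_apply] using hnorm

/-- **Converse bookkeeping**: if `(f)·R₀⟦T⟧ = (L)` and `f_0 = … = f_{r-1} = 0`, then `‖f_r‖ = ‖L_r‖`
(`L = ι(f)·u` with `u ∈ R₀⟦T⟧ˣ`, `L_r = ι(f)_r·u(0)`, `‖u(0)‖ = 1`). [cite: Washington1997, §7.1] -/
theorem norm_coeff_eq_of_map_span_eq_span {f : IwasawaAlgebra p} {L : UnrSeries p} {r : ℕ}
    (heq : (Ideal.span {f}).map (PowerSeries.map (toUnr p)) = Ideal.span {L})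
    (hf : ∀ i < r, coeff i f = 0) :
    ‖((coeff r f : ℤ_[p]) : ℚ_[p])‖ = ‖((coeff r L : unrIntegers p) : ℂ_[p])‖ := by
  rw [CongruenceLimit.map_span_singleton_powerSeries, Ideal.span_singleton_eq_span_singleton] at heq
  obtain ⟨u, hu⟩ := heq
  have hLr : coeff r L = coeff r (PowerSeries.map (toUnr p) f) * constantCoeff (u : UnrSeries p) := by
    rw [← hu, coeff_mul_eq_of_coeff_lt_eq_zero (u : UnrSeries p)
      (fun i hi ↦ (coeff_map_toUnr_eq_zero_iff f i).mpr (hf i hi))]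
  have hu0 : ‖((constantCoeff (u : UnrSeries p) : unrIntegers p) : ℂ_[p])‖ = 1 :=
    (unrIntegers.isUnit_iff_norm_eq_one _).mp (PowerSeries.isUnit_constantCoeff _ u.isUnit)
  rw [← norm_coeff_map_toUnr, hLr, Subring.coe_mul, norm_mul, hu0, mul_one]

/-- A non-zero power series has a first non-zero coefficient. [folklore] -/
theorem exists_first_coeff_ne_zero {R : Type*} [Semiring R] {f : PowerSeries R} (hf : f ≠ 0) :
    ∃ r : ℕ, (∀ i < r, coeff i f = 0) ∧ coeff r f ≠ 0 := by
  have hex : ∃ n : ℕ, coeff n f ≠ 0 := by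
    by_contra h
    exact hf (PowerSeries.ext fun n ↦ by rw [map_zero]; exact not_not.mp (not_exists.mp h n))
  exact ⟨Nat.find hex, fun i hi ↦ not_not.mp (Nat.find_min hex hi), Nat.find_spec hex⟩

end Algebra

/-! ### §2 On the CTL₀ locus: UTD 20395 + `E_𝟙` ⟹ the equality, hence crux E there; and conversely -/

/-- **The `(∅,0)` main-conjecture EQUALITY on the CTL₀ locus from UTD's Kolyvagin inclusion and `E_𝟙`.**
`hKo` = the signature of route UTD's crux `AdditiveSplitIMCInclusionAtThree` (stmt-BirchSwinnertonDyer-20395)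
VERBATIM, displayed; `hE1` = the value-at-𝟙 residual `E_𝟙` of crux E exactly as displayed by
`WildSplitEisensteinInclusionAtThreeValueAtOne.valueAtOne_of_wildSplitEisensteinInclusionAtThree` (w3 g0). Conclusion:
under crux E's binders and torsion guard VERBATIM, for every generator `f` of `Ch_Λ(X_(∅,0))` with `f(𝟙) ≠ 0`
(CTL₀), `Ch_Λ(X_(∅,0))·R₀⟦T⟧ = (L)` (`map_span_eq_span_of_span_le_of_norm_constantCoeff_le`). Nothing is asserted
about `hKo` or `hE1`. [cite: JetchevSkinnerWan2017, §7.4.1 (arXiv:1512.06894 p. 30)] [cite: Washington1997, §7.1] -/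
theorem imcEqualityCTL_of_kolyvaginInclusion_of_valueAtOne
    (hKo : ∀ (W : WeierstrassCurve ℚ) [W.IsElliptic] [W.IsGloballyMinimal] (N : ℕ) [NeZero N] (K : Type) [Field K] [NumberField K] (Dt : Literature.NumberTheory.EllipticCurves.ModularForms.ModularParametrizationData W N), Summit.BirchSwinnertonDyer.Rank1Residual.Additive.ClassO6 W 3 → W.HasSurjectiveModNGaloisRep 3 → W.analyticRank = 1 → W.conductorNorm ℤ = N → Literature.NumberTheory.EllipticCurves.IsImaginaryQuadratic K → Literature.NumberTheory.EllipticCurves.SatisfiesHeegnerHypothesis N K → ∀ (κ : Literature.NumberTheory.EllipticCurves.ZpExtension K 3), κ.IsAnticyclotomic → ∀ (γ : Field.absoluteGaloisGroup K) [Fact (κ.IsTopGenerator γ)] (𝔭 : IsDedekindDomain.HeightOneSpectrum (NumberField.RingOfIntegers K)), ((3 : ℕ) : NumberField.RingOfIntegers K) ∈ 𝔭.asIdeal → 𝔭.asIdeal.ramificationIdx (NumberField.RingOfIntegers ℚ) = 1 → 𝔭.asIdeal.inertiaDeg (NumberField.RingOfIntegers ℚ) = 1 → ∀ (𝔭' :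 IsDedekindDomain.HeightOneSpectrum (NumberField.RingOfIntegers K)), ((3 : ℕ) : NumberField.RingOfIntegers K) ∈ 𝔭'.asIdeal → 𝔭' ≠ 𝔭 → ∀ (ι' : PadicAlgCl 3 ≃+* ℂ), Summit.BirchSwinnertonDyer.BirchSwinnertonDyer.Theorems.SchneiderFree.BranchInducesPrime 3 ι' 𝔭 → ∀ (ΩK : ℂ) (Ωp : ℂ_[3]) (L : Literature.NumberTheory.EllipticCurves.UnrSeries 3), ΩK ≠ 0 → Ωp ≠ 0 → Literature.NumberTheory.EllipticCurves.IsBDPLFunction ι' 𝔭 κ γ Dt.f ΩK Ωp L → Ideal.span {L} ≤ (Summit.BirchSwinnertonDyer.Rank1Residual.X11b.AcSelmer.XAc.charIdeal (W.baseChange K) 3 κ 𝔭' ∅ γ).map (PowerSeries.map (Summit.BirchSwinnertonDyer.Rank1Residual.X11b.Halves.toUnr 3)))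
    (hE1 : ∀ (W : WeierstrassCurve ℚ) [W.IsElliptic] [W.IsGloballyMinimal] (N : ℕ) [NeZero N] (K : Type) [Field K] [NumberField K] (Dt : Literature.NumberTheory.EllipticCurves.ModularForms.ModularParametrizationData W N), Summit.BirchSwinnertonDyer.Rank1Residual.Additive.ClassO6 W 3 → W.HasSurjectiveModNGaloisRep 3 → W.analyticRank = 1 → W.conductorNorm ℤ = N → Literature.NumberTheory.EllipticCurves.IsImaginaryQuadratic K → Literature.NumberTheory.EllipticCurves.SatisfiesHeegnerHypothesis N K → ∀ (κ : Literature.NumberTheory.EllipticCurves.ZpExtension K 3), κ.IsAnticyclotomic → ∀ (γ : Field.absoluteGaloisGroup K) [Fact (κ.IsTopGenerator γ)] (𝔭 : IsDedekindDomain.HeightOneSpectrum (NumberField.RingOfIntegers K)), ((3 : ℕ) : NumberField.RingOfIntegers K) ∈ 𝔭.asIdeal → 𝔭.asIdeal.ramificationIdx (NumberField.RingOfIntegers ℚ) = 1 → 𝔭.asIdeal.inertiaDeg (NumberField.RingOfIntegers ℚ) = 1 → ∀ (𝔭' : IsDedekindDomain.HeightOneSpectrum (NumberField.RingOfIntegers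 K)), ((3 : ℕ) : NumberField.RingOfIntegers K) ∈ 𝔭'.asIdeal → 𝔭' ≠ 𝔭 → ∀ (ι' : PadicAlgCl 3 ≃+* ℂ), Summit.BirchSwinnertonDyer.BirchSwinnertonDyer.Theorems.SchneiderFree.BranchInducesPrime 3 ι' 𝔭 → ∀ (ΩK : ℂ) (Ωp : ℂ_[3]) (L : Literature.NumberTheory.EllipticCurves.UnrSeries 3), ΩK ≠ 0 → Ωp ≠ 0 → Literature.NumberTheory.EllipticCurves.IsBDPLFunction ι' 𝔭 κ γ Dt.f ΩK Ωp L → Module.IsTorsion (Literature.NumberTheory.EllipticCurves.IwasawaAlgebra 3) (Summit.BirchSwinnertonDyer.Rank1Residual.X11b.AcSelmer.XAc (W.baseChange K) 3 κ 𝔭' ∅ γ) → ∀ (f : Literature.NumberTheory.EllipticCurves.IwasawaAlgebra 3), Summit.BirchSwinnertonDyer.Rank1Residual.X11b.AcSelmer.XAc.charIdeal (W.baseChange K) 3 κ 𝔭' ∅ γ = Ideal.span {f} → ‖((PowerSeries.constantCoeff f : ℤ_[3]) : ℚ_[3])‖ ≤ ‖((PowerSeries.constantCoeff L : Literature.NumberTheory.EllipticCurves.unrIntegers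 3) : ℂ_[3])‖) :
    ∀ (W : WeierstrassCurve ℚ) [W.IsElliptic] [W.IsGloballyMinimal] (N : ℕ) [NeZero N] (K : Type) [Field K] [NumberField K] (Dt : Literature.NumberTheory.EllipticCurves.ModularForms.ModularParametrizationData W N), Summit.BirchSwinnertonDyer.Rank1Residual.Additive.ClassO6 W 3 → W.HasSurjectiveModNGaloisRep 3 → W.analyticRank = 1 → W.conductorNorm ℤ = N → Literature.NumberTheory.EllipticCurves.IsImaginaryQuadratic K → Literature.NumberTheory.EllipticCurves.SatisfiesHeegnerHypothesis N K → ∀ (κ : Literature.NumberTheory.EllipticCurves.ZpExtension K 3), κ.IsAnticyclotomic → ∀ (γ : Field.absoluteGaloisGroup K) [Fact (κ.IsTopGenerator γ)] (𝔭 : IsDedekindDomain.HeightOneSpectrum (NumberField.RingOfIntegers K)), ((3 : ℕ) : NumberField.RingOfIntegers K) ∈ 𝔭.asIdeal → 𝔭.asIdeal.ramificationIdx (NumberField.RingOfIntegers ℚ) = 1 → 𝔭.asIdeal.inertiaDeg (NumberField.RingOfIntegers ℚ) = 1 → ∀ (𝔭' : IsDedekindDomain.HeightOneSpectrum (NumberField.RingOfIntegers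 K)), ((3 : ℕ) : NumberField.RingOfIntegers K) ∈ 𝔭'.asIdeal → 𝔭' ≠ 𝔭 → ∀ (ι' : PadicAlgCl 3 ≃+* ℂ), Summit.BirchSwinnertonDyer.BirchSwinnertonDyer.Theorems.SchneiderFree.BranchInducesPrime 3 ι' 𝔭 → ∀ (ΩK : ℂ) (Ωp : ℂ_[3]) (L : Literature.NumberTheory.EllipticCurves.UnrSeries 3), ΩK ≠ 0 → Ωp ≠ 0 → Literature.NumberTheory.EllipticCurves.IsBDPLFunction ι' 𝔭 κ γ Dt.f ΩK Ωp L → Module.IsTorsion (Literature.NumberTheory.EllipticCurves.IwasawaAlgebra 3) (Summit.BirchSwinnertonDyer.Rank1Residual.X11b.AcSelmer.XAc (W.baseChange K) 3 κ 𝔭' ∅ γ) → ∀ (f : Literature.NumberTheory.EllipticCurves.IwasawaAlgebra 3), Summit.BirchSwinnertonDyer.Rank1Residual.X11b.AcSelmer.XAc.charIdeal (W.baseChange K) 3 κ 𝔭' ∅ γ = Ideal.span {f} → PowerSeries.constantCoeff f ≠ 0 → (Summit.BirchSwinnertonDyer.Rank1Residual.X11b.AcSelmer.XAc.charIdeal (W.baseChange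 K) 3 κ 𝔭' ∅ γ).map (PowerSeries.map (Summit.BirchSwinnertonDyer.Rank1Residual.X11b.Halves.toUnr 3)) = Ideal.span {L} := by
  intro W _ _ N _ K _ _ Dt hO6 hsurj hr1 hN hK hH κ hκ γ _ 𝔭 h𝔭 he hf 𝔭' h𝔭' hne ι' hι ΩK Ωp L hΩK hΩp hL htor f hfI hf0
  have hko := hKo W N K Dt hO6 hsurj hr1 hN hK hH κ hκ γ 𝔭 h𝔭 he hf 𝔭' h𝔭' hne ι' hι ΩK Ωp L hΩK hΩp hL
  have he1 := hE1 W N K Dt hO6 hsurj hr1 hN hK hH κ hκ γ 𝔭 h𝔭 he hf 𝔭' h𝔭' hne ι' hι ΩK Ωp L hΩK hΩp hL htor f hfI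
  rw [hfI] at hko ⊢
  exact map_span_eq_span_of_span_le_of_norm_constantCoeff_le hko hf0 he1

/-- **Crux E on the CTL₀ locus (`E^{CTL₀}`) from UTD 20395 and `E_𝟙`** — the converse of w3's
`valueAtOne_of_wildSplitEisensteinInclusionAtThree` on the locus where the kernel consumes E. `E^{CTL₀}` is the
displayed conclusion (crux E's binders and torsion guard verbatim; «for every generator `f` of `Ch_Λ(X_(∅,0))`
with `f(𝟙) ≠ 0`, `Ch_Λ(X_(∅,0))·R₀⟦T⟧ ⊆ (L)`»), not a new item. [cite: JetchevSkinnerWan2017, §7.4.1 (arXiv:1512.06894 p. 30)] -/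
theorem cruxCTL_of_kolyvaginInclusion_of_valueAtOne
    (hKo : ∀ (W : WeierstrassCurve ℚ) [W.IsElliptic] [W.IsGloballyMinimal] (N : ℕ) [NeZero N] (K : Type) [Field K] [NumberField K] (Dt : Literature.NumberTheory.EllipticCurves.ModularForms.ModularParametrizationData W N), Summit.BirchSwinnertonDyer.Rank1Residual.Additive.ClassO6 W 3 → W.HasSurjectiveModNGaloisRep 3 → W.analyticRank = 1 → W.conductorNorm ℤ = N → Literature.NumberTheory.EllipticCurves.IsImaginaryQuadratic K → Literature.NumberTheory.EllipticCurves.SatisfiesHeegnerHypothesis N K → ∀ (κ : Literature.NumberTheory.EllipticCurves.ZpExtension K 3), κ.IsAnticyclotomic → ∀ (γ : Field.absoluteGaloisGroup K) [Fact (κ.IsTopGenerator γ)] (𝔭 : IsDedekindDomain.HeightOneSpectrum (NumberField.RingOfIntegers K)), ((3 : ℕ) : NumberField.RingOfIntegers K) ∈ 𝔭.asIdeal → 𝔭.asIdeal.ramificationIdx (NumberField.RingOfIntegers ℚ) = 1 → 𝔭.asIdeal.inertiaDeg (NumberField.RingOfIntegers ℚ) = 1 → ∀ (𝔭' : IsDedekindDomain.HeightOneSpectrum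 (NumberField.RingOfIntegers K)), ((3 : ℕ) : NumberField.RingOfIntegers K) ∈ 𝔭'.asIdeal → 𝔭' ≠ 𝔭 → ∀ (ι' : PadicAlgCl 3 ≃+* ℂ), Summit.BirchSwinnertonDyer.BirchSwinnertonDyer.Theorems.SchneiderFree.BranchInducesPrime 3 ι' 𝔭 → ∀ (ΩK : ℂ) (Ωp : ℂ_[3]) (L : Literature.NumberTheory.EllipticCurves.UnrSeries 3), ΩK ≠ 0 → Ωp ≠ 0 → Literature.NumberTheory.EllipticCurves.IsBDPLFunction ι' 𝔭 κ γ Dt.f ΩK Ωp L → Ideal.span {L} ≤ (Summit.BirchSwinnertonDyer.Rank1Residual.X11b.AcSelmer.XAc.charIdeal (W.baseChange K) 3 κ 𝔭' ∅ γ).map (PowerSeries.map (Summit.BirchSwinnertonDyer.Rank1Residual.X11b.Halves.toUnr 3)))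
    (hE1 : ∀ (W : WeierstrassCurve ℚ) [W.IsElliptic] [W.IsGloballyMinimal] (N : ℕ) [NeZero N] (K : Type) [Field K] [NumberField K] (Dt : Literature.NumberTheory.EllipticCurves.ModularForms.ModularParametrizationData W N), Summit.BirchSwinnertonDyer.Rank1Residual.Additive.ClassO6 W 3 → W.HasSurjectiveModNGaloisRep 3 → W.analyticRank = 1 → W.conductorNorm ℤ = N → Literature.NumberTheory.EllipticCurves.IsImaginaryQuadratic K → Literature.NumberTheory.EllipticCurves.SatisfiesHeegnerHypothesis N K → ∀ (κ : Literature.NumberTheory.EllipticCurves.ZpExtension K 3), κ.IsAnticyclotomic → ∀ (γ : Field.absoluteGaloisGroup K) [Fact (κ.IsTopGenerator γ)] (𝔭 : IsDedekindDomain.HeightOneSpectrum (NumberField.RingOfIntegers K)), ((3 : ℕ) : NumberField.RingOfIntegers K) ∈ 𝔭.asIdeal → 𝔭.asIdeal.ramificationIdx (NumberField.RingOfIntegers ℚ) = 1 → 𝔭.asIdeal.inertiaDeg (NumberField.RingOfIntegers ℚ) = 1 → ∀ (𝔭' : IsDedekindDomain.HeightOneSpectrum (NumberField.RingOfIntegers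 K)), ((3 : ℕ) : NumberField.RingOfIntegers K) ∈ 𝔭'.asIdeal → 𝔭' ≠ 𝔭 → ∀ (ι' : PadicAlgCl 3 ≃+* ℂ), Summit.BirchSwinnertonDyer.BirchSwinnertonDyer.Theorems.SchneiderFree.BranchInducesPrime 3 ι' 𝔭 → ∀ (ΩK : ℂ) (Ωp : ℂ_[3]) (L : Literature.NumberTheory.EllipticCurves.UnrSeries 3), ΩK ≠ 0 → Ωp ≠ 0 → Literature.NumberTheory.EllipticCurves.IsBDPLFunction ι' 𝔭 κ γ Dt.f ΩK Ωp L → Module.IsTorsion (Literature.NumberTheory.EllipticCurves.IwasawaAlgebra 3) (Summit.BirchSwinnertonDyer.Rank1Residual.X11b.AcSelmer.XAc (W.baseChange K) 3 κ 𝔭' ∅ γ) → ∀ (f : Literature.NumberTheory.EllipticCurves.IwasawaAlgebra 3), Summit.BirchSwinnertonDyer.Rank1Residual.X11b.AcSelmer.XAc.charIdeal (W.baseChange K) 3 κ 𝔭' ∅ γ = Ideal.span {f} → ‖((PowerSeries.constantCoeff f : ℤ_[3]) : ℚ_[3])‖ ≤ ‖((PowerSeries.constantCoeff L : Literature.NumberTheory.EllipticCurves.unrIntegers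 3) : ℂ_[3])‖) :
    ∀ (W : WeierstrassCurve ℚ) [W.IsElliptic] [W.IsGloballyMinimal] (N : ℕ) [NeZero N] (K : Type) [Field K] [NumberField K] (Dt : Literature.NumberTheory.EllipticCurves.ModularForms.ModularParametrizationData W N), Summit.BirchSwinnertonDyer.Rank1Residual.Additive.ClassO6 W 3 → W.HasSurjectiveModNGaloisRep 3 → W.analyticRank = 1 → W.conductorNorm ℤ = N → Literature.NumberTheory.EllipticCurves.IsImaginaryQuadratic K → Literature.NumberTheory.EllipticCurves.SatisfiesHeegnerHypothesis N K → ∀ (κ : Literature.NumberTheory.EllipticCurves.ZpExtension K 3), κ.IsAnticyclotomic → ∀ (γ : Field.absoluteGaloisGroup K) [Fact (κ.IsTopGenerator γ)] (𝔭 : IsDedekindDomain.HeightOneSpectrum (NumberField.RingOfIntegers K)), ((3 : ℕ) : NumberField.RingOfIntegers K) ∈ 𝔭.asIdeal → 𝔭.asIdeal.ramificationIdx (NumberField.RingOfIntegers ℚ) = 1 → 𝔭.asIdeal.inertiaDeg (NumberField.RingOfIntegers ℚ) = 1 → ∀ (𝔭' : IsDedekindDomain.HeightOneSpectrum (NumberField.RingOfIntegers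 K)), ((3 : ℕ) : NumberField.RingOfIntegers K) ∈ 𝔭'.asIdeal → 𝔭' ≠ 𝔭 → ∀ (ι' : PadicAlgCl 3 ≃+* ℂ), Summit.BirchSwinnertonDyer.BirchSwinnertonDyer.Theorems.SchneiderFree.BranchInducesPrime 3 ι' 𝔭 → ∀ (ΩK : ℂ) (Ωp : ℂ_[3]) (L : Literature.NumberTheory.EllipticCurves.UnrSeries 3), ΩK ≠ 0 → Ωp ≠ 0 → Literature.NumberTheory.EllipticCurves.IsBDPLFunction ι' 𝔭 κ γ Dt.f ΩK Ωp L → Module.IsTorsion (Literature.NumberTheory.EllipticCurves.IwasawaAlgebra 3) (Summit.BirchSwinnertonDyer.Rank1Residual.X11b.AcSelmer.XAc (W.baseChange K) 3 κ 𝔭' ∅ γ) → ∀ (f : Literature.NumberTheory.EllipticCurves.IwasawaAlgebra 3), Summit.BirchSwinnertonDyer.Rank1Residual.X11b.AcSelmer.XAc.charIdeal (W.baseChange K) 3 κ 𝔭' ∅ γ = Ideal.span {f} → PowerSeries.constantCoeff f ≠ 0 → (Summit.BirchSwinnertonDyer.Rank1Residual.X11b.AcSelmer.XAc.charIdeal (W.baseChange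 K) 3 κ 𝔭' ∅ γ).map (PowerSeries.map (Summit.BirchSwinnertonDyer.Rank1Residual.X11b.Halves.toUnr 3)) ≤ Ideal.span {L} := by
  intro W _ _ N _ K _ _ Dt hO6 hsurj hr1 hN hK hH κ hκ γ _ 𝔭 h𝔭 he hf 𝔭' h𝔭' hne ι' hι ΩK Ωp L hΩK hΩp hL htor f hfI hf0
  exact (imcEqualityCTL_of_kolyvaginInclusion_of_valueAtOne hKo hE1 W N K Dt hO6 hsurj hr1 hN hK hH κ hκ γ 𝔭 h𝔭 he hf 𝔭' h𝔭' hne ι' hι ΩK Ωp L hΩK hΩp hL htor f hfI hf0).le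

/-- `E ⟹ E^{CTL₀}` (the locus restriction forgets a hypothesis). [folklore] -/
theorem cruxCTL_of_crux (hE : WildSplitEisensteinInclusionAtThree) :
    ∀ (W : WeierstrassCurve ℚ) [W.IsElliptic] [W.IsGloballyMinimal] (N : ℕ) [NeZero N] (K : Type) [Field K] [NumberField K] (Dt : Literature.NumberTheory.EllipticCurves.ModularForms.ModularParametrizationData W N), Summit.BirchSwinnertonDyer.Rank1Residual.Additive.ClassO6 W 3 → W.HasSurjectiveModNGaloisRep 3 → W.analyticRank = 1 → W.conductorNorm ℤ = N → Literature.NumberTheory.EllipticCurves.IsImaginaryQuadratic K → Literature.NumberTheory.EllipticCurves.SatisfiesHeegnerHypothesis N K → ∀ (κ : Literature.NumberTheory.EllipticCurves.ZpExtension K 3), κ.IsAnticyclotomic → ∀ (γ : Field.absoluteGaloisGroup K) [Fact (κ.IsTopGenerator γ)] (𝔭 : IsDedekindDomain.HeightOneSpectrum (NumberField.RingOfIntegers K)), ((3 : ℕ) : NumberField.RingOfIntegers K) ∈ 𝔭.asIdeal → 𝔭.asIdeal.ramificationIdx (NumberField.RingOfIntegers ℚ) = 1 → 𝔭.asIdeal.inertiaDeg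 (NumberField.RingOfIntegers ℚ) = 1 → ∀ (𝔭' : IsDedekindDomain.HeightOneSpectrum (NumberField.RingOfIntegers K)), ((3 : ℕ) : NumberField.RingOfIntegers K) ∈ 𝔭'.asIdeal → 𝔭' ≠ 𝔭 → ∀ (ι' : PadicAlgCl 3 ≃+* ℂ), Summit.BirchSwinnertonDyer.BirchSwinnertonDyer.Theorems.SchneiderFree.BranchInducesPrime 3 ι' 𝔭 → ∀ (ΩK : ℂ) (Ωp : ℂ_[3]) (L : Literature.NumberTheory.EllipticCurves.UnrSeries 3), ΩK ≠ 0 → Ωp ≠ 0 → Literature.NumberTheory.EllipticCurves.IsBDPLFunction ι' 𝔭 κ γ Dt.f ΩK Ωp L → Module.IsTorsion (Literature.NumberTheory.EllipticCurves.IwasawaAlgebra 3) (Summit.BirchSwinnertonDyer.Rank1Residual.X11b.AcSelmer.XAc (W.baseChange K) 3 κ 𝔭' ∅ γ) → ∀ (f : Literature.NumberTheory.EllipticCurves.IwasawaAlgebra 3), Summit.BirchSwinnertonDyer.Rank1Residual.X11b.AcSelmer.XAc.charIdeal (W.baseChange K) 3 κ 𝔭' ∅ γ = Ideal.span {f} →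 PowerSeries.constantCoeff f ≠ 0 → (Summit.BirchSwinnertonDyer.Rank1Residual.X11b.AcSelmer.XAc.charIdeal (W.baseChange K) 3 κ 𝔭' ∅ γ).map (PowerSeries.map (Summit.BirchSwinnertonDyer.Rank1Residual.X11b.Halves.toUnr 3)) ≤ Ideal.span {L} := by
  intro W _ _ N _ K _ _ Dt hO6 hsurj hr1 hN hK hH κ hκ γ _ 𝔭 h𝔭 he hf 𝔭' h𝔭' hne ι' hι ΩK Ωp L hΩK hΩp hL htor f _ _
  exact hE W N K Dt hO6 hsurj hr1 hN hK hH κ hκ γ 𝔭 h𝔭 he hf 𝔭' h𝔭' hne ι' hι ΩK Ωp L hΩK hΩp hL htor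

/-- **`E^{CTL₀} ⟹ E_𝟙`**: at a generator `f` with `f(𝟙) ≠ 0` this is w3's algebra
(`norm_constantCoeff_le_of_map_mem_span`); at a generator with `f(𝟙) = 0` the inequality `‖0‖ ≤ ‖L(𝟙)‖` is
empty. Hence `E_𝟙` is a consequence of `E^{CTL₀}` alone. [folklore] -/
theorem valueAtOne_of_cruxCTL
    (hCTL : ∀ (W : WeierstrassCurve ℚ) [W.IsElliptic] [W.IsGloballyMinimal] (N : ℕ) [NeZero N] (K : Type) [Field K] [NumberField K] (Dt : Literature.NumberTheory.EllipticCurves.ModularForms.ModularParametrizationData W N), Summit.BirchSwinnertonDyer.Rank1Residual.Additive.ClassO6 W 3 → W.HasSurjectiveModNGaloisRep 3 → W.analyticRank = 1 → W.conductorNorm ℤ = N → Literature.NumberTheory.EllipticCurves.IsImaginaryQuadratic K → Literature.NumberTheory.EllipticCurves.SatisfiesHeegnerHypothesis N K → ∀ (κ : Literature.NumberTheory.EllipticCurves.ZpExtension K 3), κ.IsAnticyclotomic → ∀ (γ : Field.absoluteGaloisGroup K) [Fact (κ.IsTopGenerator γ)] (𝔭 : IsDedekindDomain.HeightOneSpectrum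 (NumberField.RingOfIntegers K)), ((3 : ℕ) : NumberField.RingOfIntegers K) ∈ 𝔭.asIdeal → 𝔭.asIdeal.ramificationIdx (NumberField.RingOfIntegers ℚ) = 1 → 𝔭.asIdeal.inertiaDeg (NumberField.RingOfIntegers ℚ) = 1 → ∀ (𝔭' : IsDedekindDomain.HeightOneSpectrum (NumberField.RingOfIntegers K)), ((3 : ℕ) : NumberField.RingOfIntegers K) ∈ 𝔭'.asIdeal → 𝔭' ≠ 𝔭 → ∀ (ι' : PadicAlgCl 3 ≃+* ℂ), Summit.BirchSwinnertonDyer.BirchSwinnertonDyer.Theorems.SchneiderFree.BranchInducesPrime 3 ι' 𝔭 → ∀ (ΩK : ℂ) (Ωp : ℂ_[3]) (L : Literature.NumberTheory.EllipticCurves.UnrSeries 3), ΩK ≠ 0 → Ωp ≠ 0 → Literature.NumberTheory.EllipticCurves.IsBDPLFunction ι' 𝔭 κ γ Dt.f ΩK Ωp L → Module.IsTorsion (Literature.NumberTheory.EllipticCurves.IwasawaAlgebra 3) (Summit.BirchSwinnertonDyer.Rank1Residual.X11b.AcSelmer.XAc (W.baseChange K) 3 κ 𝔭' ∅ γ) →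 ∀ (f : Literature.NumberTheory.EllipticCurves.IwasawaAlgebra 3), Summit.BirchSwinnertonDyer.Rank1Residual.X11b.AcSelmer.XAc.charIdeal (W.baseChange K) 3 κ 𝔭' ∅ γ = Ideal.span {f} → PowerSeries.constantCoeff f ≠ 0 → (Summit.BirchSwinnertonDyer.Rank1Residual.X11b.AcSelmer.XAc.charIdeal (W.baseChange K) 3 κ 𝔭' ∅ γ).map (PowerSeries.map (Summit.BirchSwinnertonDyer.Rank1Residual.X11b.Halves.toUnr 3)) ≤ Ideal.span {L}) :
    ∀ (W : WeierstrassCurve ℚ) [W.IsElliptic] [W.IsGloballyMinimal] (N : ℕ) [NeZero N] (K : Type) [Field K] [NumberField K] (Dt : Literature.NumberTheory.EllipticCurves.ModularForms.ModularParametrizationData W N), Summit.BirchSwinnertonDyer.Rank1Residual.Additive.ClassO6 W 3 → W.HasSurjectiveModNGaloisRep 3 → W.analyticRank = 1 → W.conductorNorm ℤ = N → Literature.NumberTheory.EllipticCurves.IsImaginaryQuadratic K → Literature.NumberTheory.EllipticCurves.SatisfiesHeegnerHypothesis N K → ∀ (κ : Literature.NumberTheory.EllipticCurves.ZpExtension K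 3), κ.IsAnticyclotomic → ∀ (γ : Field.absoluteGaloisGroup K) [Fact (κ.IsTopGenerator γ)] (𝔭 : IsDedekindDomain.HeightOneSpectrum (NumberField.RingOfIntegers K)), ((3 : ℕ) : NumberField.RingOfIntegers K) ∈ 𝔭.asIdeal → 𝔭.asIdeal.ramificationIdx (NumberField.RingOfIntegers ℚ) = 1 → 𝔭.asIdeal.inertiaDeg (NumberField.RingOfIntegers ℚ) = 1 → ∀ (𝔭' : IsDedekindDomain.HeightOneSpectrum (NumberField.RingOfIntegers K)), ((3 : ℕ) : NumberField.RingOfIntegers K) ∈ 𝔭'.asIdeal → 𝔭' ≠ 𝔭 → ∀ (ι' : PadicAlgCl 3 ≃+* ℂ), Summit.BirchSwinnertonDyer.BirchSwinnertonDyer.Theorems.SchneiderFree.BranchInducesPrime 3 ι' 𝔭 → ∀ (ΩK : ℂ) (Ωp : ℂ_[3]) (L : Literature.NumberTheory.EllipticCurves.UnrSeries 3), ΩK ≠ 0 → Ωp ≠ 0 → Literature.NumberTheory.EllipticCurves.IsBDPLFunction ι' 𝔭 κ γ Dt.f ΩK Ωp L → Module.IsTorsion (Literature.NumberTheory.EllipticCurves.IwasawaAlgebra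 3) (Summit.BirchSwinnertonDyer.Rank1Residual.X11b.AcSelmer.XAc (W.baseChange K) 3 κ 𝔭' ∅ γ) → ∀ (f : Literature.NumberTheory.EllipticCurves.IwasawaAlgebra 3), Summit.BirchSwinnertonDyer.Rank1Residual.X11b.AcSelmer.XAc.charIdeal (W.baseChange K) 3 κ 𝔭' ∅ γ = Ideal.span {f} → ‖((PowerSeries.constantCoeff f : ℤ_[3]) : ℚ_[3])‖ ≤ ‖((PowerSeries.constantCoeff L : Literature.NumberTheory.EllipticCurves.unrIntegers 3) : ℂ_[3])‖ := by
  intro W _ _ N _ K _ _ Dt hO6 hsurj hr1 hN hK hH κ hκ γ _ 𝔭 h𝔭 he hf 𝔭' h𝔭' hne ι' hι ΩK Ωp L hΩK hΩp hL htor f hfI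
  by_cases hf0 : PowerSeries.constantCoeff f = 0
  · rw [hf0, PadicInt.coe_zero, norm_zero]
    exact norm_nonneg _
  · have hincl := hCTL W N K Dt hO6 hsurj hr1 hN hK hH κ hκ γ 𝔭 h𝔭 he hf 𝔭' h𝔭' hne ι' hι ΩK Ωp L hΩK hΩp hL htor f hfI hf0
    rw [hfI, CongruenceLimit.map_span_singleton_powerSeries] at hincl
    exact WildSplitEisensteinInclusionAtThreeValueAtOne.norm_constantCoeff_le_of_map_mem_span 3
      ((Ideal.span_singleton_le_iff_mem _).mp hincl)

/-- **Modulo UTD's wall 20395, `E^{CTL₀} ⟺ E_𝟙`.** On the locus where the route's kernel consumes crux E (a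
generator of `Ch_Λ(X_(∅,0))` non-vanishing at `𝟙`, supplied by control), the Λ-adic Eisenstein inclusion and its
bottom-layer shadow are EQUIVALENT given the Kolyvagin inclusion (displayed hypothesis `hKo`, UTD 20395 verbatim).
[cite: JetchevSkinnerWan2017, §7.4.1 (arXiv:1512.06894 p. 30)] [cite: Washington1997, §7.1] -/
theorem cruxCTL_iff_valueAtOne_of_kolyvaginInclusion
    (hKo : ∀ (W : WeierstrassCurve ℚ) [W.IsElliptic] [W.IsGloballyMinimal] (N : ℕ) [NeZero N] (K : Type) [Field K] [NumberField K] (Dt : Literature.NumberTheory.EllipticCurves.ModularForms.ModularParametrizationData W N), Summit.BirchSwinnertonDyer.Rank1Residual.Additive.ClassO6 W 3 → W.HasSurjectiveModNGaloisRep 3 → W.analyticRank = 1 → W.conductorNorm ℤ = N → Literature.NumberTheory.EllipticCurves.IsImaginaryQuadratic K → Literature.NumberTheory.EllipticCurves.SatisfiesHeegnerHypothesis N K → ∀ (κ : Literature.NumberTheory.EllipticCurves.ZpExtension K 3), κ.IsAnticyclotomic → ∀ (γ : Field.absoluteGaloisGroup K) [Fact (κ.IsTopGenerator γ)] (𝔭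 : IsDedekindDomain.HeightOneSpectrum (NumberField.RingOfIntegers K)), ((3 : ℕ) : NumberField.RingOfIntegers K) ∈ 𝔭.asIdeal → 𝔭.asIdeal.ramificationIdx (NumberField.RingOfIntegers ℚ) = 1 → 𝔭.asIdeal.inertiaDeg (NumberField.RingOfIntegers ℚ) = 1 → ∀ (𝔭' : IsDedekindDomain.HeightOneSpectrum (NumberField.RingOfIntegers K)), ((3 : ℕ) : NumberField.RingOfIntegers K) ∈ 𝔭'.asIdeal → 𝔭' ≠ 𝔭 → ∀ (ι' : PadicAlgCl 3 ≃+* ℂ), Summit.BirchSwinnertonDyer.BirchSwinnertonDyer.Theorems.SchneiderFree.BranchInducesPrime 3 ι' 𝔭 → ∀ (ΩK : ℂ) (Ωp : ℂ_[3]) (L : Literature.NumberTheory.EllipticCurves.UnrSeries 3), ΩK ≠ 0 → Ωp ≠ 0 → Literature.NumberTheory.EllipticCurves.IsBDPLFunction ι' 𝔭 κ γ Dt.f ΩK Ωp L → Ideal.span {L} ≤ (Summit.BirchSwinnertonDyer.Rank1Residual.X11b.AcSelmer.XAc.charIdeal (W.baseChange K) 3 κ 𝔭' ∅ γ).map (PowerSeries.map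 (Summit.BirchSwinnertonDyer.Rank1Residual.X11b.Halves.toUnr 3))) :
    (∀ (W : WeierstrassCurve ℚ) [W.IsElliptic] [W.IsGloballyMinimal] (N : ℕ) [NeZero N] (K : Type) [Field K] [NumberField K] (Dt : Literature.NumberTheory.EllipticCurves.ModularForms.ModularParametrizationData W N), Summit.BirchSwinnertonDyer.Rank1Residual.Additive.ClassO6 W 3 → W.HasSurjectiveModNGaloisRep 3 → W.analyticRank = 1 → W.conductorNorm ℤ = N → Literature.NumberTheory.EllipticCurves.IsImaginaryQuadratic K → Literature.NumberTheory.EllipticCurves.SatisfiesHeegnerHypothesis N K → ∀ (κ : Literature.NumberTheory.EllipticCurves.ZpExtension K 3), κ.IsAnticyclotomic → ∀ (γ : Field.absoluteGaloisGroup K) [Fact (κ.IsTopGenerator γ)] (𝔭 : IsDedekindDomain.HeightOneSpectrum (NumberField.RingOfIntegers K)), ((3 : ℕ) : NumberField.RingOfIntegers K) ∈ 𝔭.asIdeal → 𝔭.asIdeal.ramificationIdx (NumberField.RingOfIntegers ℚ) = 1 → 𝔭.asIdeal.inertiaDeg (NumberField.RingOfIntegers ℚ) = 1 → ∀ (𝔭'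 : IsDedekindDomain.HeightOneSpectrum (NumberField.RingOfIntegers K)), ((3 : ℕ) : NumberField.RingOfIntegers K) ∈ 𝔭'.asIdeal → 𝔭' ≠ 𝔭 → ∀ (ι' : PadicAlgCl 3 ≃+* ℂ), Summit.BirchSwinnertonDyer.BirchSwinnertonDyer.Theorems.SchneiderFree.BranchInducesPrime 3 ι' 𝔭 → ∀ (ΩK : ℂ) (Ωp : ℂ_[3]) (L : Literature.NumberTheory.EllipticCurves.UnrSeries 3), ΩK ≠ 0 → Ωp ≠ 0 → Literature.NumberTheory.EllipticCurves.IsBDPLFunction ι' 𝔭 κ γ Dt.f ΩK Ωp L → Module.IsTorsion (Literature.NumberTheory.EllipticCurves.IwasawaAlgebra 3) (Summit.BirchSwinnertonDyer.Rank1Residual.X11b.AcSelmer.XAc (W.baseChange K) 3 κ 𝔭' ∅ γ) → ∀ (f : Literature.NumberTheory.EllipticCurves.IwasawaAlgebra 3), Summit.BirchSwinnertonDyer.Rank1Residual.X11b.AcSelmer.XAc.charIdeal (W.baseChange K) 3 κ 𝔭' ∅ γ = Ideal.span {f} → PowerSeries.constantCoeff f ≠ 0 → (Summit.BirchSwinnertonDyer.Rank1Residual.X11b.AcSelmer.XAc.charIdeal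 (W.baseChange K) 3 κ 𝔭' ∅ γ).map (PowerSeries.map (Summit.BirchSwinnertonDyer.Rank1Residual.X11b.Halves.toUnr 3)) ≤ Ideal.span {L}) ↔
      (∀ (W : WeierstrassCurve ℚ) [W.IsElliptic] [W.IsGloballyMinimal] (N : ℕ) [NeZero N] (K : Type) [Field K] [NumberField K] (Dt : Literature.NumberTheory.EllipticCurves.ModularForms.ModularParametrizationData W N), Summit.BirchSwinnertonDyer.Rank1Residual.Additive.ClassO6 W 3 → W.HasSurjectiveModNGaloisRep 3 → W.analyticRank = 1 → W.conductorNorm ℤ = N → Literature.NumberTheory.EllipticCurves.IsImaginaryQuadratic K → Literature.NumberTheory.EllipticCurves.SatisfiesHeegnerHypothesis N K → ∀ (κ : Literature.NumberTheory.EllipticCurves.ZpExtension K 3), κ.IsAnticyclotomic → ∀ (γ : Field.absoluteGaloisGroup K) [Fact (κ.IsTopGenerator γ)] (𝔭 : IsDedekindDomain.HeightOneSpectrum (NumberField.RingOfIntegers K)), ((3 : ℕ) : NumberField.RingOfIntegers K) ∈ 𝔭.asIdeal → 𝔭.asIdeal.ramificationIdx (NumberField.RingOfIntegers ℚ) = 1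 → 𝔭.asIdeal.inertiaDeg (NumberField.RingOfIntegers ℚ) = 1 → ∀ (𝔭' : IsDedekindDomain.HeightOneSpectrum (NumberField.RingOfIntegers K)), ((3 : ℕ) : NumberField.RingOfIntegers K) ∈ 𝔭'.asIdeal → 𝔭' ≠ 𝔭 → ∀ (ι' : PadicAlgCl 3 ≃+* ℂ), Summit.BirchSwinnertonDyer.BirchSwinnertonDyer.Theorems.SchneiderFree.BranchInducesPrime 3 ι' 𝔭 → ∀ (ΩK : ℂ) (Ωp : ℂ_[3]) (L : Literature.NumberTheory.EllipticCurves.UnrSeries 3), ΩK ≠ 0 → Ωp ≠ 0 → Literature.NumberTheory.EllipticCurves.IsBDPLFunction ι' 𝔭 κ γ Dt.f ΩK Ωp L → Module.IsTorsion (Literature.NumberTheory.EllipticCurves.IwasawaAlgebra 3) (Summit.BirchSwinnertonDyer.Rank1Residual.X11b.AcSelmer.XAc (W.baseChange K) 3 κ 𝔭' ∅ γ) → ∀ (f : Literature.NumberTheory.EllipticCurves.IwasawaAlgebra 3), Summit.BirchSwinnertonDyer.Rank1Residual.X11b.AcSelmer.XAc.charIdeal (W.baseChange K) 3 κ 𝔭'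 ∅ γ = Ideal.span {f} → ‖((PowerSeries.constantCoeff f : ℤ_[3]) : ℚ_[3])‖ ≤ ‖((PowerSeries.constantCoeff L : Literature.NumberTheory.EllipticCurves.unrIntegers 3) : ℂ_[3])‖) :=
  ⟨valueAtOne_of_cruxCTL, cruxCTL_of_kolyvaginInclusion_of_valueAtOne hKo⟩

/-- **SOED's leaf from `E^{CTL₀}` in place of E**: `PublishedInputsWildThree → E^{CTL₀} → WildKolyvaginUpperAtThree →
WildSplitWaldspurgerAtThree → WildSplitControlAtThree → WildRankZeroTwistAtThree → WildRankOneSurjNonTowerAtThree →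
WAllExclAddWildRankOneSurj`, through w3's `wAllExclAddWildRankOneSurj_of_valueAtOne` and `valueAtOne_of_cruxCTL`.
Every crux is an antecedent; BSD is not proved by this. [cite: JetchevSkinnerWan2017, §7.4.1 (arXiv:1512.06894 p. 30)] -/
theorem wAllExclAddWildRankOneSurj_of_cruxCTL (hF : PublishedInputsWildThree)
    (hCTL : ∀ (W : WeierstrassCurve ℚ) [W.IsElliptic] [W.IsGloballyMinimal] (N : ℕ) [NeZero N] (K : Type) [Field K] [NumberField K] (Dt : Literature.NumberTheory.EllipticCurves.ModularForms.ModularParametrizationData W N), Summit.BirchSwinnertonDyer.Rank1Residual.Additive.ClassO6 W 3 → W.HasSurjectiveModNGaloisRep 3 → W.analyticRank = 1 → W.conductorNorm ℤ = N → Literature.NumberTheory.EllipticCurves.IsImaginaryQuadratic K → Literature.NumberTheory.EllipticCurves.SatisfiesHeegnerHypothesis N K → ∀ (κ : Literature.NumberTheory.EllipticCurves.ZpExtension K 3), κ.IsAnticyclotomic → ∀ (γ : Field.absoluteGaloisGroup K) [Fact (κ.IsTopGenerator γ)] (𝔭 : IsDedekindDomain.HeightOneSpectrum (NumberField.RingOfIntegers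 K)), ((3 : ℕ) : NumberField.RingOfIntegers K) ∈ 𝔭.asIdeal → 𝔭.asIdeal.ramificationIdx (NumberField.RingOfIntegers ℚ) = 1 → 𝔭.asIdeal.inertiaDeg (NumberField.RingOfIntegers ℚ) = 1 → ∀ (𝔭' : IsDedekindDomain.HeightOneSpectrum (NumberField.RingOfIntegers K)), ((3 : ℕ) : NumberField.RingOfIntegers K) ∈ 𝔭'.asIdeal → 𝔭' ≠ 𝔭 → ∀ (ι' : PadicAlgCl 3 ≃+* ℂ), Summit.BirchSwinnertonDyer.BirchSwinnertonDyer.Theorems.SchneiderFree.BranchInducesPrime 3 ι' 𝔭 → ∀ (ΩK : ℂ) (Ωp : ℂ_[3]) (L : Literature.NumberTheory.EllipticCurves.UnrSeries 3), ΩK ≠ 0 → Ωp ≠ 0 → Literature.NumberTheory.EllipticCurves.IsBDPLFunction ι' 𝔭 κ γ Dt.f ΩK Ωp L → Module.IsTorsion (Literature.NumberTheory.EllipticCurves.IwasawaAlgebra 3) (Summit.BirchSwinnertonDyer.Rank1Residual.X11b.AcSelmer.XAc (W.baseChange K) 3 κ 𝔭' ∅ γ) → ∀ (f : Literature.NumberTheory.EllipticCurves.IwasawaAlgebra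 3), Summit.BirchSwinnertonDyer.Rank1Residual.X11b.AcSelmer.XAc.charIdeal (W.baseChange K) 3 κ 𝔭' ∅ γ = Ideal.span {f} → PowerSeries.constantCoeff f ≠ 0 → (Summit.BirchSwinnertonDyer.Rank1Residual.X11b.AcSelmer.XAc.charIdeal (W.baseChange K) 3 κ 𝔭' ∅ γ).map (PowerSeries.map (Summit.BirchSwinnertonDyer.Rank1Residual.X11b.Halves.toUnr 3)) ≤ Ideal.span {L})
    (hKoly : WildKolyvaginUpperAtThree) (hV : WildSplitWaldspurgerAtThree) (hC : WildSplitControlAtThree)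
    (hZ : WildRankZeroTwistAtThree) (hNT : WildRankOneSurjNonTowerAtThree) :
    Summit.BirchSwinnertonDyer.WAllExclAddWildRankOneSurj :=
  WildSplitEisensteinInclusionAtThreeValueAtOne.wAllExclAddWildRankOneSurj_of_valueAtOne hF
    (valueAtOne_of_cruxCTL hCTL) hKoly hV hC hZ hNT

/-! ### §3 Off the locus: the leading-term display `E_lead`; modulo 20395, crux E BY NAME ⟺ `E_lead` -/

/-- **Crux E BY NAME from UTD's Kolyvagin inclusion and the leading-term inequality `E_lead`.** `hKo` = UTD 20395
verbatim (displayed); `hLead` = `E_lead`: under crux E's binders and torsion guard verbatim, for every generator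
`f` of `Ch_Λ(X_(∅,0))` and every `r` with `f_0 = … = f_{r-1} = 0 ≠ f_r`, `‖f_r‖₃ ≤ ‖L_r‖` (the leading Taylor
coefficients at the trivial character; `r = 0` is `E_𝟙` on the CTL₀ locus). Conclusion: the crux
`WildSplitEisensteinInclusionAtThree` itself — at each instance `Ch_Λ` is principal (Literature
`charIdeal_isPrincipal_holds`), a zero generator makes the inclusion empty, and otherwise
`map_span_eq_span_of_span_le_of_norm_coeff_le` at the first non-zero coefficient. Nothing is asserted about `hKo`
or `hLead`. [cite: Washington1997, §7.1 and §13.2] -/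
theorem crux_of_kolyvaginInclusion_of_leadingTerm
    (hKo : ∀ (W : WeierstrassCurve ℚ) [W.IsElliptic] [W.IsGloballyMinimal] (N : ℕ) [NeZero N] (K : Type) [Field K] [NumberField K] (Dt : Literature.NumberTheory.EllipticCurves.ModularForms.ModularParametrizationData W N), Summit.BirchSwinnertonDyer.Rank1Residual.Additive.ClassO6 W 3 → W.HasSurjectiveModNGaloisRep 3 → W.analyticRank = 1 → W.conductorNorm ℤ = N → Literature.NumberTheory.EllipticCurves.IsImaginaryQuadratic K → Literature.NumberTheory.EllipticCurves.SatisfiesHeegnerHypothesis N K → ∀ (κ : Literature.NumberTheory.EllipticCurves.ZpExtension K 3), κ.IsAnticyclotomic → ∀ (γ : Field.absoluteGaloisGroup K) [Fact (κ.IsTopGenerator γ)] (𝔭 : IsDedekindDomain.HeightOneSpectrum (NumberField.RingOfIntegers K)), ((3 : ℕ) : NumberField.RingOfIntegers K) ∈ 𝔭.asIdeal → 𝔭.asIdeal.ramificationIdx (NumberField.RingOfIntegers ℚ) = 1 → 𝔭.asIdeal.inertiaDeg (NumberField.RingOfIntegers ℚ) = 1 → ∀ (𝔭' : IsDedekindDomain.HeightOneSpectrum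 (NumberField.RingOfIntegers K)), ((3 : ℕ) : NumberField.RingOfIntegers K) ∈ 𝔭'.asIdeal → 𝔭' ≠ 𝔭 → ∀ (ι' : PadicAlgCl 3 ≃+* ℂ), Summit.BirchSwinnertonDyer.BirchSwinnertonDyer.Theorems.SchneiderFree.BranchInducesPrime 3 ι' 𝔭 → ∀ (ΩK : ℂ) (Ωp : ℂ_[3]) (L : Literature.NumberTheory.EllipticCurves.UnrSeries 3), ΩK ≠ 0 → Ωp ≠ 0 → Literature.NumberTheory.EllipticCurves.IsBDPLFunction ι' 𝔭 κ γ Dt.f ΩK Ωp L → Ideal.span {L} ≤ (Summit.BirchSwinnertonDyer.Rank1Residual.X11b.AcSelmer.XAc.charIdeal (W.baseChange K) 3 κ 𝔭' ∅ γ).map (PowerSeries.map (Summit.BirchSwinnertonDyer.Rank1Residual.X11b.Halves.toUnr 3)))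
    (hLead : ∀ (W : WeierstrassCurve ℚ) [W.IsElliptic] [W.IsGloballyMinimal] (N : ℕ) [NeZero N] (K : Type) [Field K] [NumberField K] (Dt : Literature.NumberTheory.EllipticCurves.ModularForms.ModularParametrizationData W N), Summit.BirchSwinnertonDyer.Rank1Residual.Additive.ClassO6 W 3 → W.HasSurjectiveModNGaloisRep 3 → W.analyticRank = 1 → W.conductorNorm ℤ = N → Literature.NumberTheory.EllipticCurves.IsImaginaryQuadratic K → Literature.NumberTheory.EllipticCurves.SatisfiesHeegnerHypothesis N K → ∀ (κ : Literature.NumberTheory.EllipticCurves.ZpExtension K 3), κ.IsAnticyclotomic → ∀ (γ : Field.absoluteGaloisGroup K) [Fact (κ.IsTopGenerator γ)] (𝔭 : IsDedekindDomain.HeightOneSpectrum (NumberField.RingOfIntegers K)), ((3 : ℕ) : NumberField.RingOfIntegers K) ∈ 𝔭.asIdeal → 𝔭.asIdeal.ramificationIdx (NumberField.RingOfIntegers ℚ) = 1 → 𝔭.asIdeal.inertiaDeg (NumberField.RingOfIntegers ℚ) = 1 → ∀ (𝔭' : IsDedekindDomain.HeightOneSpectrum (NumberField.RingOfIntegers K)),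 ((3 : ℕ) : NumberField.RingOfIntegers K) ∈ 𝔭'.asIdeal → 𝔭' ≠ 𝔭 → ∀ (ι' : PadicAlgCl 3 ≃+* ℂ), Summit.BirchSwinnertonDyer.BirchSwinnertonDyer.Theorems.SchneiderFree.BranchInducesPrime 3 ι' 𝔭 → ∀ (ΩK : ℂ) (Ωp : ℂ_[3]) (L : Literature.NumberTheory.EllipticCurves.UnrSeries 3), ΩK ≠ 0 → Ωp ≠ 0 → Literature.NumberTheory.EllipticCurves.IsBDPLFunction ι' 𝔭 κ γ Dt.f ΩK Ωp L → Module.IsTorsion (Literature.NumberTheory.EllipticCurves.IwasawaAlgebra 3) (Summit.BirchSwinnertonDyer.Rank1Residual.X11b.AcSelmer.XAc (W.baseChange K) 3 κ 𝔭' ∅ γ) → ∀ (f : Literature.NumberTheory.EllipticCurves.IwasawaAlgebra 3) (r : ℕ), Summit.BirchSwinnertonDyer.Rank1Residual.X11b.AcSelmer.XAc.charIdeal (W.baseChange K) 3 κ 𝔭' ∅ γ = Ideal.span {f} → (∀ i < r, PowerSeries.coeff i f = 0) → PowerSeries.coeff r f ≠ 0 → ‖((PowerSeries.coeff r f : ℤ_[3])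 : ℚ_[3])‖ ≤ ‖((PowerSeries.coeff r L : Literature.NumberTheory.EllipticCurves.unrIntegers 3) : ℂ_[3])‖) :
    WildSplitEisensteinInclusionAtThree := by
  intro W _ _ N _ K _ _ Dt hO6 hsurj hr1 hN hK hH κ hκ γ _ 𝔭 h𝔭 he hf 𝔭' h𝔭' hne ι' hι ΩK Ωp L hΩK hΩp hL htor
  have hP : (Summit.BirchSwinnertonDyer.Rank1Residual.X11b.AcSelmer.XAc.charIdeal (W.baseChange K) 3 κ 𝔭' ∅ γ).IsPrincipal :=
    charIdeal_isPrincipal_holds 3 (Summit.BirchSwinnertonDyer.Rank1Residual.X11b.AcSelmer.XAc (W.baseChange K) 3 κ 𝔭' ∅ γ)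
  obtain ⟨f, hfI'⟩ := hP
  have hfI : Summit.BirchSwinnertonDyer.Rank1Residual.X11b.AcSelmer.XAc.charIdeal (W.baseChange K) 3 κ 𝔭' ∅ γ =
      Ideal.span {f} := by
    rw [hfI', Ideal.submodule_span_eq]
  by_cases hf0 : f = 0
  · rw [hfI, hf0, Ideal.span_singleton_eq_bot.mpr rfl, Ideal.map_bot]
    exact bot_le
  obtain ⟨r, hlt, hr⟩ := exists_first_coeff_ne_zero hf0
  have hko := hKo W N K Dt hO6 hsurj hr1 hN hK hH κ hκ γ 𝔭 h𝔭 he hf 𝔭' h𝔭' hne ι' hι ΩK Ωp L hΩK hΩp hL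
  rw [hfI] at hko ⊢
  exact (map_span_eq_span_of_span_le_of_norm_coeff_le hko hlt hr
    (hLead W N K Dt hO6 hsurj hr1 hN hK hH κ hκ γ 𝔭 h𝔭 he hf 𝔭' h𝔭' hne ι' hι ΩK Ωp L hΩK hΩp hL htor f r hfI hlt hr)).le

/-- **E + UTD 20395 ⟹ `E_lead`** (as an equality of norms: the two inclusions make `Ch·R₀⟦T⟧ = (L)`, and
associated generators have leading coefficients of the same norm, `norm_coeff_eq_of_map_span_eq_span`).
[cite: Washington1997, §7.1] -/
theorem leadingTerm_of_crux_of_kolyvaginInclusion (hE : WildSplitEisensteinInclusionAtThree)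
    (hKo : ∀ (W : WeierstrassCurve ℚ) [W.IsElliptic] [W.IsGloballyMinimal] (N : ℕ) [NeZero N] (K : Type) [Field K] [NumberField K] (Dt : Literature.NumberTheory.EllipticCurves.ModularForms.ModularParametrizationData W N), Summit.BirchSwinnertonDyer.Rank1Residual.Additive.ClassO6 W 3 → W.HasSurjectiveModNGaloisRep 3 → W.analyticRank = 1 → W.conductorNorm ℤ = N → Literature.NumberTheory.EllipticCurves.IsImaginaryQuadratic K → Literature.NumberTheory.EllipticCurves.SatisfiesHeegnerHypothesis N K → ∀ (κ : Literature.NumberTheory.EllipticCurves.ZpExtension K 3), κ.IsAnticyclotomic → ∀ (γ : Field.absoluteGaloisGroup K) [Fact (κ.IsTopGenerator γ)] (𝔭 : IsDedekindDomain.HeightOneSpectrum (NumberField.RingOfIntegers K)), ((3 : ℕ) : NumberField.RingOfIntegers K) ∈ 𝔭.asIdeal → 𝔭.asIdeal.ramificationIdx (NumberField.RingOfIntegers ℚ) = 1 → 𝔭.asIdeal.inertiaDeg (NumberField.RingOfIntegers ℚ) = 1 → ∀ (𝔭' : IsDedekindDomain.HeightOneSpectrum (NumberField.RingOfIntegers K)),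 ((3 : ℕ) : NumberField.RingOfIntegers K) ∈ 𝔭'.asIdeal → 𝔭' ≠ 𝔭 → ∀ (ι' : PadicAlgCl 3 ≃+* ℂ), Summit.BirchSwinnertonDyer.BirchSwinnertonDyer.Theorems.SchneiderFree.BranchInducesPrime 3 ι' 𝔭 → ∀ (ΩK : ℂ) (Ωp : ℂ_[3]) (L : Literature.NumberTheory.EllipticCurves.UnrSeries 3), ΩK ≠ 0 → Ωp ≠ 0 → Literature.NumberTheory.EllipticCurves.IsBDPLFunction ι' 𝔭 κ γ Dt.f ΩK Ωp L → Ideal.span {L} ≤ (Summit.BirchSwinnertonDyer.Rank1Residual.X11b.AcSelmer.XAc.charIdeal (W.baseChange K) 3 κ 𝔭' ∅ γ).map (PowerSeries.map (Summit.BirchSwinnertonDyer.Rank1Residual.X11b.Halves.toUnr 3))) :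
    ∀ (W : WeierstrassCurve ℚ) [W.IsElliptic] [W.IsGloballyMinimal] (N : ℕ) [NeZero N] (K : Type) [Field K] [NumberField K] (Dt : Literature.NumberTheory.EllipticCurves.ModularForms.ModularParametrizationData W N), Summit.BirchSwinnertonDyer.Rank1Residual.Additive.ClassO6 W 3 → W.HasSurjectiveModNGaloisRep 3 → W.analyticRank = 1 → W.conductorNorm ℤ = N → Literature.NumberTheory.EllipticCurves.IsImaginaryQuadratic K → Literature.NumberTheory.EllipticCurves.SatisfiesHeegnerHypothesis N K → ∀ (κ : Literature.NumberTheory.EllipticCurves.ZpExtension K 3), κ.IsAnticyclotomic → ∀ (γ : Field.absoluteGaloisGroup K) [Fact (κ.IsTopGenerator γ)] (𝔭 : IsDedekindDomain.HeightOneSpectrum (NumberField.RingOfIntegers K)), ((3 : ℕ) : NumberField.RingOfIntegers K) ∈ 𝔭.asIdeal → 𝔭.asIdeal.ramificationIdx (NumberField.RingOfIntegers ℚ) = 1 → 𝔭.asIdeal.inertiaDeg (NumberField.RingOfIntegers ℚ) = 1 → ∀ (𝔭' : IsDedekindDomain.HeightOneSpectrum (NumberField.RingOfIntegers K)), ((3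 : ℕ) : NumberField.RingOfIntegers K) ∈ 𝔭'.asIdeal → 𝔭' ≠ 𝔭 → ∀ (ι' : PadicAlgCl 3 ≃+* ℂ), Summit.BirchSwinnertonDyer.BirchSwinnertonDyer.Theorems.SchneiderFree.BranchInducesPrime 3 ι' 𝔭 → ∀ (ΩK : ℂ) (Ωp : ℂ_[3]) (L : Literature.NumberTheory.EllipticCurves.UnrSeries 3), ΩK ≠ 0 → Ωp ≠ 0 → Literature.NumberTheory.EllipticCurves.IsBDPLFunction ι' 𝔭 κ γ Dt.f ΩK Ωp L → Module.IsTorsion (Literature.NumberTheory.EllipticCurves.IwasawaAlgebra 3) (Summit.BirchSwinnertonDyer.Rank1Residual.X11b.AcSelmer.XAc (W.baseChange K) 3 κ 𝔭' ∅ γ) → ∀ (f : Literature.NumberTheory.EllipticCurves.IwasawaAlgebra 3) (r : ℕ), Summit.BirchSwinnertonDyer.Rank1Residual.X11b.AcSelmer.XAc.charIdeal (W.baseChange K) 3 κ 𝔭' ∅ γ = Ideal.span {f} → (∀ i < r, PowerSeries.coeff i f = 0) → PowerSeries.coeff r f ≠ 0 → ‖((PowerSeries.coeff r f : ℤ_[3])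 : ℚ_[3])‖ ≤ ‖((PowerSeries.coeff r L : Literature.NumberTheory.EllipticCurves.unrIntegers 3) : ℂ_[3])‖ := by
  intro W _ _ N _ K _ _ Dt hO6 hsurj hr1 hN hK hH κ hκ γ _ 𝔭 h𝔭 he hf 𝔭' h𝔭' hne ι' hι ΩK Ωp L hΩK hΩp hL htor f r hfI hlt _
  have heq : (Ideal.span {f}).map (PowerSeries.map (toUnr 3)) = Ideal.span {L} := by
    rw [← hfI]
    exact le_antisymm (hE W N K Dt hO6 hsurj hr1 hN hK hH κ hκ γ 𝔭 h𝔭 he hf 𝔭' h𝔭' hne ι' hι ΩK Ωp L hΩK hΩp hL htor) (hKo W N K Dt hO6 hsurj hr1 hN hK hH κ hκ γ 𝔭 h𝔭 he hf 𝔭' h𝔭' hne ι' hι ΩK Ωp L hΩK hΩp hL)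
  exact (norm_coeff_eq_of_map_span_eq_span heq hlt).le

/-- **Modulo UTD's wall 20395, crux E ⟺ `E_lead`** — the complete bottom-layer characterisation of the crux
given the Kolyvagin inclusion, with no locus restriction. [cite: Washington1997, §7.1 and §13.2] -/
theorem crux_iff_leadingTerm_of_kolyvaginInclusion
    (hKo : ∀ (W : WeierstrassCurve ℚ) [W.IsElliptic] [W.IsGloballyMinimal] (N : ℕ) [NeZero N] (K : Type) [Field K] [NumberField K] (Dt : Literature.NumberTheory.EllipticCurves.ModularForms.ModularParametrizationData W N), Summit.BirchSwinnertonDyer.Rank1Residual.Additive.ClassO6 W 3 → W.HasSurjectiveModNGaloisRep 3 → W.analyticRank = 1 → W.conductorNorm ℤ = N → Literature.NumberTheory.EllipticCurves.IsImaginaryQuadratic K → Literature.NumberTheory.EllipticCurves.SatisfiesHeegnerHypothesis N K → ∀ (κ : Literature.NumberTheory.EllipticCurves.ZpExtension K 3), κ.IsAnticyclotomic → ∀ (γ : Field.absoluteGaloisGroup K) [Fact (κ.IsTopGenerator γ)] (𝔭 : IsDedekindDomain.HeightOneSpectrum (NumberField.RingOfIntegers K)), ((3 : ℕ) : NumberField.RingOfIntegers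 K) ∈ 𝔭.asIdeal → 𝔭.asIdeal.ramificationIdx (NumberField.RingOfIntegers ℚ) = 1 → 𝔭.asIdeal.inertiaDeg (NumberField.RingOfIntegers ℚ) = 1 → ∀ (𝔭' : IsDedekindDomain.HeightOneSpectrum (NumberField.RingOfIntegers K)), ((3 : ℕ) : NumberField.RingOfIntegers K) ∈ 𝔭'.asIdeal → 𝔭' ≠ 𝔭 → ∀ (ι' : PadicAlgCl 3 ≃+* ℂ), Summit.BirchSwinnertonDyer.BirchSwinnertonDyer.Theorems.SchneiderFree.BranchInducesPrime 3 ι' 𝔭 → ∀ (ΩK : ℂ) (Ωp : ℂ_[3]) (L : Literature.NumberTheory.EllipticCurves.UnrSeries 3), ΩK ≠ 0 → Ωp ≠ 0 → Literature.NumberTheory.EllipticCurves.IsBDPLFunction ι' 𝔭 κ γ Dt.f ΩK Ωp L → Ideal.span {L} ≤ (Summit.BirchSwinnertonDyer.Rank1Residual.X11b.AcSelmer.XAc.charIdeal (W.baseChange K) 3 κ 𝔭' ∅ γ).map (PowerSeries.map (Summit.BirchSwinnertonDyer.Rank1Residual.X11b.Halves.toUnr 3))) :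
    WildSplitEisensteinInclusionAtThree ↔
      (∀ (W : WeierstrassCurve ℚ) [W.IsElliptic] [W.IsGloballyMinimal] (N : ℕ) [NeZero N] (K : Type) [Field K] [NumberField K] (Dt : Literature.NumberTheory.EllipticCurves.ModularForms.ModularParametrizationData W N), Summit.BirchSwinnertonDyer.Rank1Residual.Additive.ClassO6 W 3 → W.HasSurjectiveModNGaloisRep 3 → W.analyticRank = 1 → W.conductorNorm ℤ = N → Literature.NumberTheory.EllipticCurves.IsImaginaryQuadratic K → Literature.NumberTheory.EllipticCurves.SatisfiesHeegnerHypothesis N K → ∀ (κ : Literature.NumberTheory.EllipticCurves.ZpExtension K 3), κ.IsAnticyclotomic → ∀ (γ : Field.absoluteGaloisGroup K) [Fact (κ.IsTopGenerator γ)] (𝔭 : IsDedekindDomain.HeightOneSpectrum (NumberField.RingOfIntegers K)), ((3 : ℕ) : NumberField.RingOfIntegers K) ∈ 𝔭.asIdeal → 𝔭.asIdeal.ramificationIdx (NumberField.RingOfIntegers ℚ) = 1 → 𝔭.asIdeal.inertiaDeg (NumberField.RingOfIntegers ℚ) = 1 → ∀ (𝔭' : IsDedekindDomain.HeightOneSpectrum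 (NumberField.RingOfIntegers K)), ((3 : ℕ) : NumberField.RingOfIntegers K) ∈ 𝔭'.asIdeal → 𝔭' ≠ 𝔭 → ∀ (ι' : PadicAlgCl 3 ≃+* ℂ), Summit.BirchSwinnertonDyer.BirchSwinnertonDyer.Theorems.SchneiderFree.BranchInducesPrime 3 ι' 𝔭 → ∀ (ΩK : ℂ) (Ωp : ℂ_[3]) (L : Literature.NumberTheory.EllipticCurves.UnrSeries 3), ΩK ≠ 0 → Ωp ≠ 0 → Literature.NumberTheory.EllipticCurves.IsBDPLFunction ι' 𝔭 κ γ Dt.f ΩK Ωp L → Module.IsTorsion (Literature.NumberTheory.EllipticCurves.IwasawaAlgebra 3) (Summit.BirchSwinnertonDyer.Rank1Residual.X11b.AcSelmer.XAc (W.baseChange K) 3 κ 𝔭' ∅ γ) → ∀ (f : Literature.NumberTheory.EllipticCurves.IwasawaAlgebra 3) (r : ℕ), Summit.BirchSwinnertonDyer.Rank1Residual.X11b.AcSelmer.XAc.charIdeal (W.baseChange K) 3 κ 𝔭' ∅ γ = Ideal.span {f} → (∀ i < r, PowerSeries.coeff i f = 0) → PowerSeries.coeff r f ≠ 0 → ‖((PowerSeries.coeff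 r f : ℤ_[3]) : ℚ_[3])‖ ≤ ‖((PowerSeries.coeff r L : Literature.NumberTheory.EllipticCurves.unrIntegers 3) : ℂ_[3])‖) :=
  ⟨fun hE ↦ leadingTerm_of_crux_of_kolyvaginInclusion hE hKo, crux_of_kolyvaginInclusion_of_leadingTerm hKo⟩

end Summit.BirchSwinnertonDyer.BirchSwinnertonDyer.Theorems.WildSplitEisensteinInclusionAtThreeLeadingTerm

end
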